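import Mathlib
import Summits.RiemannHypothesis.RiemannHypothesis.Theorems.WeilFarFloorCramerCrossMean
import HarnessLib

/-!
# The Cesàro mean of the Cramér autocorrelation energy is `2β` when `F(U)/U → β` and the primitive of `g` is bounded (RH-free)

Helper file (`--supports stmt-RiemannHypothesis-0098`, lead-track anchor: Weil-positivity window ladder, format-C far bound),
pure proofs.  Seat rh-explicit-weil-1 gen16 (memo `run/shared/lean/pub/rh-explicit/rh-explicit-weil-1/FORMAT-K3.md` §17).

Inputs: `WeilFarFloorCramerFunction` (`g`, `Φ = 2F(2b) + 2X(b)`, `F` monotone, the Cesàro lemma `tendsto_cesaro_of_tendsto_div`),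
`WeilFarFloorCramerCrossMean` (`|∫₁^A X| ≤ C∫₀^{2A}|g|` from a bounded primitive).  The two analytic inputs enter as HYPOTHESES —
`F(U)/U → β` (MV Thm. 13.6 under RH: Literature `CramerMeanSquare.tendsto_mean_sq_psi_exp_sub_of_RH`, `β = Σ m²/|ρ|²`) and
`|∫₀^V g| ≤ C` (under RH: `WeilFarFloorCramerPrimitiveRH`) — so this file is RH-free; the RH corollary is drawn in `WeilFarFloorCoshGapMeanRH`.
* Cauchy–Schwarz `(∫₀^{2A}|g|)² ≤ 2A·F(2A)` (inlined discriminant argument), and ★★ `tendsto_cesaro_cramerLagEnergy`: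
  **`F(U)/U → β ∧ |∫₀^V g| ≤ C ⟹ (1/A²)∫₁^A Φ(b) db → 2β`**.  Under RH (`β = β₂ = Σ_ρ m(ρ)²/|ρ|²`) and with
  `WeilFarFloorResidualEnergyCramer` (`J(b) = (e^b/4P)Φ(b) + O(√Φ + 1)`, `e^b/4P → ½`): the residual energy `J` — the coefficient of
  the floor gap `λ_max(a) − R_c(a) = (1+o(1))J(a)/R_c(a)` — has Cesàro slope `β₂` (`= β_F = 2 + γ − log 4π` if the zeros are simple:
  the same constant that bounds the C-XIII discrepancy).
Standard axioms only.  Nothing here bears on the truth of RH.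
-/

set_option linter.dupNamespace false
set_option autoImplicit false

noncomputable section

open MeasureTheory Set Filter Topology
open scoped Real BigOperators ArithmeticFunction.vonMangoldt Chebyshev

namespace Summit.RiemannHypothesis.RiemannHypothesis.Theorems.WeilFormatC

namespace FloorResidualMean

variable {b : ℝ}

/-! ## The Cesàro mean of the Cramér autocorrelation energy -/

/-- Cauchy–Schwarz on `[0, 2A]`: `(∫₀^{2A}|g|)² ≤ 2A·F(2A)`. -/
theorem sq_integral_abs_cramerFn_le {A : ℝ} (hA : 0 ≤ A) :
    (∫ u in (0 : ℝ)..(2 * A), |Real.exp (-(u / 2)) * (ψ (Real.exp u) - Real.exp u)|) ^ 2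
      ≤ 2 * A * ∫ u in (0 : ℝ)..(2 * A), Real.exp (-u) * (ψ (Real.exp u) - Real.exp u) ^ 2 := by
  set g : ℝ → ℝ := fun u ↦ Real.exp (-(u / 2)) * (ψ (Real.exp u) - Real.exp u) with hg
  have hA2 : (0 : ℝ) ≤ 2 * A := by linarith
  set μ : Measure ℝ := volume.restrict (Ioc 0 (2 * A)) with hμ
  have hfin : volume (Ioc 0 (2 * A)) ≠ ⊤ := by rw [Real.volume_Ioc]; exact ENNReal.ofReal_ne_top
  set K := ψ (Real.exp (2 * A)) + Real.exp (2 * A) with hK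
  have hgb : ∀ᵐ u ∂μ, ‖|g u|‖ ≤ K := by
    refine (ae_restrict_iff' measurableSet_Ioc).2 (ae_of_all _ fun u hu ↦ ?_)
    rw [Real.norm_eq_abs, abs_abs]
    exact abs_cramerFn_le hA2 hu.2
  have hgm : Measurable fun u ↦ |g u| := measurable_cramerFn.abs
  have i_f : IntegrableOn (fun u ↦ |g u|) (Ioc 0 (2 * A)) := Measure.integrableOn_of_bounded hfin hgm.aestronglyMeasurable hgb
  have i_ff : Integrable (fun u ↦ |g u| ^ 2) μ := by
    refine Measure.integrableOn_of_bounded hfin (hgm.pow_const 2).aestronglyMeasurable (M := K ^ 2) ?_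
    refine (ae_restrict_iff' measurableSet_Ioc).2 (ae_of_all _ fun u hu ↦ ?_)
    rw [Real.norm_eq_abs, abs_pow, abs_abs]
    exact pow_le_pow_left₀ (abs_nonneg _) (abs_cramerFn_le hA2 hu.2) 2
  have i_fg : Integrable (fun u ↦ |g u| * 1) μ := by
    have : (fun u ↦ |g u| * 1) = fun u ↦ |g u| := by funext u; ring
    rw [this, hμ]; exact i_f
  have i_gg : Integrable (fun _ : ℝ ↦ (1 : ℝ) ^ 2) μ := by simp [hμ]
  -- Cauchy–Schwarz for μ (discriminant of ∫(f − t)² ≥ 0), inlined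
  have hcs : (∫ u, |g u| * 1 ∂μ) ^ 2 ≤ (∫ u, |g u| ^ 2 ∂μ) * ∫ _u, (1 : ℝ) ^ 2 ∂μ := by
    set Aμ := ∫ u, |g u| ^ 2 ∂μ with hAμ
    set Bμ := ∫ u, |g u| * 1 ∂μ with hBμ
    set Cμ := ∫ _u : ℝ, (1 : ℝ) ^ 2 ∂μ with hCμ
    have hnn : ∀ t : ℝ, 0 ≤ Aμ - 2 * t * Bμ + t ^ 2 * Cμ := by
      intro t
      have hpt : (fun u ↦ (|g u| - t * 1) ^ 2) = fun u ↦ |g u| ^ 2 - 2 * t * (|g u| * 1) + t ^ 2 * (1 : ℝ) ^ 2 := by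
        funext u; ring
      have i0 : Integrable (fun u ↦ 2 * t * (|g u| * 1)) μ := i_fg.const_mul _
      have i1 : Integrable (fun u ↦ |g u| ^ 2 - 2 * t * (|g u| * 1)) μ := i_ff.sub i0
      have i2 : Integrable (fun _ : ℝ ↦ t ^ 2 * (1 : ℝ) ^ 2) μ := i_gg.const_mul _
      have h0 : 0 ≤ ∫ u, (|g u| - t * 1) ^ 2 ∂μ := integral_nonneg fun u ↦ sq_nonneg _
      rw [hpt, integral_add i1 i2, integral_sub i_ff i0, integral_const_mul, integral_const_mul] at h0
      rw [hAμ, hBμ, hCμ]; linarith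
    have hC0' : 0 ≤ Cμ := integral_nonneg fun u ↦ sq_nonneg _
    rcases hC0'.eq_or_lt with hC0'' | hCpos
    · have hB0 : Bμ = 0 := by
        by_contra hne
        have h1 := hnn ((Aμ + 1) / (2 * Bμ))
        rw [← hC0'', mul_zero, add_zero] at h1
        have h2 : 2 * ((Aμ + 1) / (2 * Bμ)) * Bμ = Aμ + 1 := by field_simp
        linarith
      rw [hB0, ← hC0'']; simp
    · have h1 := hnn (Bμ / Cμ)
      have h2 : Aμ - 2 * (Bμ / Cμ) * Bμ + (Bμ / Cμ) ^ 2 * Cμ = (Aμ * Cμ - Bμ ^ 2) / Cμ := by field_simp; ring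
      rw [h2] at h1
      rcases div_nonneg_iff.1 h1 with ⟨h3, -⟩ | ⟨-, h4⟩
      · linarith
      · linarith
  have e1 : ∫ u, |g u| * 1 ∂μ = ∫ u in (0 : ℝ)..(2 * A), |g u| := by
    simp only [mul_one]; rw [hμ, intervalIntegral.integral_of_le hA2]
  have e2 : ∫ u, |g u| ^ 2 ∂μ = ∫ u in (0 : ℝ)..(2 * A), Real.exp (-u) * (ψ (Real.exp u) - Real.exp u) ^ 2 := by
    rw [hμ, intervalIntegral.integral_of_le hA2]
    refine setIntegral_congr_fun measurableSet_Ioc fun u _ ↦ ?_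
    rw [sq_abs]; exact cramerFn_sq u
  have e3 : ∫ _u, (1 : ℝ) ^ 2 ∂μ = 2 * A := by
    simp [hμ, hA2]
  rw [e1, e2, e3] at hcs
  linarith

/-- **THE CESÀRO MEAN OF THE CRAMÉR AUTOCORRELATION ENERGY** (RH-free, hypothesis-explicit): if the mean square
`F(U) = ∫₀^U g²` satisfies `F(U)/U → β` (MV Thm. 13.6 under RH, `β = Σ_ρ m(ρ)²/|ρ|²`) and the primitive of `g` is bounded
(`|∫₀^V g| ≤ C`, true under RH), then `(1/A²)∫₁^A Φ(b) db → 2β`, `Φ(b) = ∫₀^{2b}(g(u) + g(2b−u))² du` — the lag-`2b` cross term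
averages out (Fubini, `WeilFarFloorCramerCrossMean`), the diagonal gives `2β`.  With `WeilFarFloorResidualEnergyCramer`
(`J(b) = (e^b/4P)Φ(b) + O(√Φ + 1)`, `e^b/4P → ½`) this says that the gap coefficient `J(b)` has Cesàro slope `β`. -/
theorem tendsto_cesaro_cramerLagEnergy {β C : ℝ}
    (hF : Tendsto (fun U : ℝ ↦ 1 / U * ∫ u in (0 : ℝ)..U, Real.exp (-u) * (ψ (Real.exp u) - Real.exp u) ^ 2) atTop (𝓝 β))
    (hC : ∀ V : ℝ, 0 ≤ V → |∫ u in (0 : ℝ)..V, Real.exp (-(u / 2)) * (ψ (Real.exp u) - Real.exp u)| ≤ C) :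
    Tendsto (fun A : ℝ ↦ 1 / A ^ 2 * ∫ b in (1 : ℝ)..A, ∫ u in (0 : ℝ)..(2 * b),
        (Real.exp (-(u / 2)) * (ψ (Real.exp u) - Real.exp u)
          + Real.exp (-((2 * b - u) / 2)) * (ψ (Real.exp (2 * b - u)) - Real.exp (2 * b - u))) ^ 2) atTop
      (𝓝 (2 * β)) := by
  set g : ℝ → ℝ := fun u ↦ Real.exp (-(u / 2)) * (ψ (Real.exp u) - Real.exp u) with hg
  set F : ℝ → ℝ := fun U ↦ ∫ u in (0 : ℝ)..U, Real.exp (-u) * (ψ (Real.exp u) - Real.exp u) ^ 2 with hFdef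
  set X : ℝ → ℝ := fun b ↦ ∫ u in (0 : ℝ)..(2 * b), g u * g (2 * b - u) with hXdef
  have hmonoF : Monotone F := monotone_cramerMeanSq
  have hmonoF2 : Monotone fun b : ℝ ↦ F (2 * b) := fun x y hxy ↦ hmonoF (by linarith)
  have hCG0 : 0 ≤ C := le_trans (abs_nonneg _) (hC 0 le_rfl)
  have hX : ∀ A : ℝ, 1 ≤ A → IntervalIntegrable X volume 1 A ∧ |∫ b in (1 : ℝ)..A, X b| ≤ C * ∫ u in (0 : ℝ)..(2 * A), |g u| :=
    fun A hA ↦ abs_integral_cross_le_of_primitive_bound hC hA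
  -- the diagonal part
  have h1 : Tendsto (fun A : ℝ ↦ 1 / A ^ 2 * ∫ b in (1 : ℝ)..A, F (2 * b)) atTop (𝓝 β) :=
    tendsto_cesaro_of_tendsto_div hmonoF hF
  -- the cross part → 0; first β ≥ 0 (F ≥ 0)
  have hβ0 : 0 ≤ β := by
    have hF0 : F 0 = 0 := by simp [hFdef]
    refine ge_of_tendsto hF (Filter.eventually_atTop.2 ⟨1, fun U hU ↦ ?_⟩)
    have h1 : 0 ≤ F U := by have := hmonoF (show (0 : ℝ) ≤ U by linarith); rwa [hF0] at this
    positivity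
  obtain ⟨U₀, hU₀⟩ := eventually_atTop.1 ((Metric.tendsto_nhds.1 hF) 1 one_pos)
  have hFle : ∀ A : ℝ, max U₀ 1 ≤ 2 * A → F (2 * A) ≤ (β + 1) * (2 * A) := by
    intro A hA
    have h := hU₀ (2 * A) (le_trans (le_max_left _ _) hA)
    rw [Real.dist_eq] at h
    have h2A : 0 < 2 * A := by have := le_max_right U₀ 1; linarith
    have h1 : 1 / (2 * A) * F (2 * A) ≤ β + 1 := by linarith [(abs_lt.1 h).2]
    have h3 := mul_le_mul_of_nonneg_left h1 h2A.le
    rw [← mul_assoc, mul_one_div_cancel h2A.ne', one_mul] at h3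
    linarith
  have h2 : Tendsto (fun A : ℝ ↦ 1 / A ^ 2 * ∫ b in (1 : ℝ)..A, X b) atTop (𝓝 0) := by
    have hbound : ∀ A : ℝ, max U₀ 1 ≤ A → |1 / A ^ 2 * ∫ b in (1 : ℝ)..A, X b| ≤ 2 * C * Real.sqrt (β + 1) * A⁻¹ := by
      intro A hA
      have hA1 : 1 ≤ A := le_trans (le_max_right _ _) hA
      have hA0 : 0 < A := by linarith
      have hXA := (hX A hA1).2
      have hcs := sq_integral_abs_cramerFn_le hA0.le
      have hFA := hFle A (by linarith [le_max_right U₀ 1, le_max_left U₀ 1])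
      set I := ∫ u in (0 : ℝ)..(2 * A), |g u| with hI
      have hI0 : 0 ≤ I := intervalIntegral.integral_nonneg (by linarith) fun u _ ↦ abs_nonneg _
      have hI2 : I ^ 2 ≤ (2 * A) ^ 2 * (β + 1) := by nlinarith
      have h0 : 0 ≤ 2 * A * Real.sqrt (β + 1) := by positivity
      have hsq : (2 * A * Real.sqrt (β + 1)) ^ 2 = (2 * A) ^ 2 * (β + 1) := by
        rw [mul_pow, Real.sq_sqrt (by positivity)]
      have hIle : I ≤ 2 * A * Real.sqrt (β + 1) := (pow_le_pow_iff_left₀ hI0 h0 two_ne_zero).1 (by rw [hsq]; exact hI2)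
      have hA2 : 0 < A ^ 2 := by positivity
      rw [abs_mul, abs_of_pos (by positivity : (0 : ℝ) < 1 / A ^ 2)]
      calc 1 / A ^ 2 * |∫ b in (1 : ℝ)..A, X b| ≤ 1 / A ^ 2 * (C * I) :=
            mul_le_mul_of_nonneg_left hXA (by positivity)
        _ ≤ 1 / A ^ 2 * (C * (2 * A * Real.sqrt (β + 1))) := by gcongr
        _ = 2 * C * Real.sqrt (β + 1) * A⁻¹ := by field_simp
    have hg0 : Tendsto (fun A : ℝ ↦ 2 * C * Real.sqrt (β + 1) * A⁻¹) atTop (𝓝 0) := by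
      simpa using tendsto_inv_atTop_zero.const_mul (2 * C * Real.sqrt (β + 1))
    refine squeeze_zero_norm' ?_ hg0
    filter_upwards [eventually_ge_atTop (max U₀ 1)] with A hA
    rw [Real.norm_eq_abs]; exact hbound A hA
  -- assembly: ∫₁^A Φ = 2∫₁^A F(2b) + 2∫₁^A X for A ≥ 1
  have hsum : Tendsto (fun A : ℝ ↦ 2 * (1 / A ^ 2 * ∫ b in (1 : ℝ)..A, F (2 * b)) + 2 * (1 / A ^ 2 * ∫ b in (1 : ℝ)..A, X b))
      atTop (𝓝 (2 * β)) := by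
    have := (h1.const_mul 2).add (h2.const_mul 2)
    simpa using this
  refine hsum.congr' ?_
  filter_upwards [eventually_ge_atTop (1 : ℝ)] with A hA1
  have hiF : IntervalIntegrable (fun b : ℝ ↦ 2 * F (2 * b)) volume 1 A := hmonoF2.intervalIntegrable.const_mul 2
  have hiX : IntervalIntegrable (fun b : ℝ ↦ 2 * X b) volume 1 A := (hX A hA1).1.const_mul 2
  have heq : ∫ b in (1 : ℝ)..A, ∫ u in (0 : ℝ)..(2 * b), (g u + g (2 * b - u)) ^ 2
      = ∫ b in (1 : ℝ)..A, (2 * F (2 * b) + 2 * X b) := by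
    refine intervalIntegral.integral_congr fun b hb ↦ ?_
    rw [uIcc_of_le hA1] at hb
    exact cramerLagEnergy_eq (b := b) (by linarith [hb.1])
  show 2 * (1 / A ^ 2 * ∫ b in (1 : ℝ)..A, F (2 * b)) + 2 * (1 / A ^ 2 * ∫ b in (1 : ℝ)..A, X b)
    = 1 / A ^ 2 * ∫ b in (1 : ℝ)..A, ∫ u in (0 : ℝ)..(2 * b), (g u + g (2 * b - u)) ^ 2
  rw [heq, intervalIntegral.integral_add hiF hiX, intervalIntegral.integral_const_mul, intervalIntegral.integral_const_mul]
  ring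

end FloorResidualMean

end Summit.RiemannHypothesis.RiemannHypothesis.Theorems.WeilFormatC
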